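import Summits.ValiantsHypothesis.ValiantsHypothesis.Theorems.KPlusLogSqLawTropicalBCyclePotential
import Summits.ValiantsHypothesis.ValiantsHypothesis.Theorems.KPlusLogSqLawTropicalBCompatiblePotentialHeight

/-!
# Route «KPlusLogSqLaw», crux `TropicalB` (stmt-ValiantsHypothesis-19771) — the EXPONENT-FREE CYCLE POTENTIAL LAW, every `K`, every design:
# orbits `≤ c` ⇒ `n ≤ m·(2c+1)^K`

HONEST FRAMING.  Helper toward the registered stubs `stub_tropThin` / `stub_tropFat` of `Cruxes/TropicalB/Lines/birth.lean` (crux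
`Summit.ValiantsHypothesis.ValiantsHypothesis.Theses.KPlusLogSqLaw.TropicalB`, item stmt-ValiantsHypothesis-19771, route KPlusLogSqLaw; cell
`pub-symmetroid`, seat val-sym-trop-p1 g25, 2026-08-29; `--supports … --as helper`).  A STRUCTURE / SECTOR theorem for dominant chains of ARBITRARY
designs; it does not bound `TropicalB` in its window (long exchange cycles escape) and bears on neither `WeakLifting`, DoorA26 / DoorA34, `MatrixDescartes`
(stmt-ValiantsHypothesis-18050) nor VP ≠ VNP.

The cell's CYCLE POTENTIAL LAW (`CyclePotential.chain_le`, p677819) bounds every dominant chain whose exchange quotients `σ_k⁻¹σ_{k+1}` have all orbits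
of size `≤ c` by `m·(U₁ − U₀)` for any class potential `u ∈ [U₀, U₁]^K` that is `c`-COMPATIBLE with the exponents (`Σ_B d∘f < Σ_B d∘g ⇒ Σ_B u∘f < Σ_B u∘g`,
`#B ≤ c`).  Heights were available only for `c`-lacunary exponents (`(c+1)^{K−1} − 1`) and for `K = 4, c = 2` (`9`, p679675).  With
`CompatHeight.exists_small_compatible` (`…TropicalBCompatiblePotentialHeight`: height `(2c+1)^K` for EVERY `d`, by a vertex of the compatibility
polyhedron and sparse Cramer) the law becomes exponent-free:

* `compatible_of_small` — the difference-vector form of compatibility (`Σ|δ| ≤ 2c`, `⟨d,δ⟩ ≥ 1 ⇒ ⟨u,δ⟩ ≥ 1`) implies the column-set form used by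
  `CyclePotential.chain_le` (class counts on `≤ c` columns differ by such a `δ`); `exists_compatible_allK` — for every `d` a `c`-compatible `u` with
  `0 ≤ u ≤ (2c+1)^K`.
* **`chain_le_allK`** — in EVERY design of format `(m, K)`, every chain of terms dominant at strictly increasing slopes with consecutive terms distinct,
  all of whose exchange quotients have orbits of size `≤ c`, has **`n ≤ m·(2c+1)^K`**; `chain_le_allK_of_shortSteps` — the same if every step changes
  `≤ c` columns (`c ≥ 1`); `chain_le_allK_of_exceptions` — with a set `J` of unrestricted steps, `n + 1 ≤ (#J + 1)(m·(2c+1)^K + 1)`: a chain of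
  `n + 1` terms in ANY design has `≥ (n+1)/(m(2c+1)^K + 1) − 1` steps whose exchange quotient has an orbit of more than `c` columns.
* READING for the crux: chains with exchange cycles of bounded length obey `TropicalB`'s inequality with `C = O(log c)` (`m·(2c+1)^K ≤ 2^{log₂ m + K·log₂(2c+1)}`)
  for ALL exponent vectors — the bounded-cycle SECTOR is inside TB; what TB bets on is the cost of the long cycles.  With the tight / single-orbit normal
  form (`…TropicalBTightNormalForm`, p683233) «orbits ≤ c» reads «the ONE cycle of each step has ≤ c columns».
[this cell's law; the height bound is folklore LP (Schrijver §8.5 (23) via `Literature.Analysis.Convex.BasicOptimumSolution`) + Cramer]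
-/

set_option linter.dupNamespace false
set_option autoImplicit false

namespace Summit.ValiantsHypothesis.ValiantsHypothesis.Theorems.KPlusLogSqLaw

open Summit.ValiantsHypothesis.ValiantsHypothesis.Theorems.MatrixDescartes.Negative
open scoped BigOperators
open Finset

namespace CyclePotential

variable {m K : ℕ}

/-- class sums over a column set, fibrewise: `Σ_{b∈B} w (f b) = Σ_l w l · #{b ∈ B : f b = l}`. [folklore] -/
theorem sum_comp_eq_sum_mul_card (B : Finset (Fin m)) (f : Fin m → Fin K) (w : Fin K → ℤ) :
    ∑ b ∈ B, w (f b) = ∑ l, w l * ((B.filter fun b => f b = l).card : ℤ) := by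
  classical
  rw [← sum_fiberwise_of_maps_to (s := B) (t := (univ : Finset (Fin K))) (g := f) (fun b _ => mem_univ (f b)) (fun b => w (f b))]
  refine sum_congr rfl fun l _ => ?_
  rw [sum_congr rfl fun b hb => by rw [(mem_filter.mp hb).2], sum_const, nsmul_eq_mul, mul_comm]

/-- **Difference-vector compatibility implies column-set compatibility.**  If `⟨d, δ⟩ ≥ 1 ⇒ ⟨u, δ⟩ ≥ 1` for every integer `δ` with `Σ|δ| ≤ 2c`, then
`u` is `c`-compatible with `d` in the sense of `CyclePotential.chain_le`. [folklore] -/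
theorem compatible_of_small (c : ℕ) (d : Fin K → ℕ) (u : Fin K → ℤ)
    (hu : ∀ δ : Fin K → ℤ, (∑ l, |δ l|) ≤ 2 * c → 1 ≤ ∑ l, (d l : ℤ) * δ l → 1 ≤ ∑ l, u l * δ l)
    (B : Finset (Fin m)) (hB : B.card ≤ c) (f g : Fin m → Fin K)
    (hfg : ∑ b ∈ B, (d (f b) : ℤ) < ∑ b ∈ B, (d (g b) : ℤ)) : ∑ b ∈ B, u (f b) < ∑ b ∈ B, u (g b) := by
  classical
  set δ : Fin K → ℤ := fun l => ((B.filter fun b => g b = l).card : ℤ) - ((B.filter fun b => f b = l).card : ℤ) with hδ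
  have key : ∀ w : Fin K → ℤ, ∑ b ∈ B, w (g b) - ∑ b ∈ B, w (f b) = ∑ l, w l * δ l := by
    intro w
    rw [sum_comp_eq_sum_mul_card B g w, sum_comp_eq_sum_mul_card B f w, ← sum_sub_distrib]
    exact sum_congr rfl fun l _ => by rw [hδ]; ring
  -- `Σ |δ| ≤ #B + #B ≤ 2c`
  have hcardg : ∑ l, ((B.filter fun b => g b = l).card : ℤ) = B.card := by
    have h := sum_comp_eq_sum_mul_card B g (fun _ => 1)
    simp only [one_mul, sum_const, nsmul_eq_mul, mul_one] at h
    exact h.symm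
  have hcardf : ∑ l, ((B.filter fun b => f b = l).card : ℤ) = B.card := by
    have h := sum_comp_eq_sum_mul_card B f (fun _ => 1)
    simp only [one_mul, sum_const, nsmul_eq_mul, mul_one] at h
    exact h.symm
  have hδ1 : (∑ l, |δ l|) ≤ 2 * c := by
    calc (∑ l, |δ l|) ≤ ∑ l, (((B.filter fun b => g b = l).card : ℤ) + ((B.filter fun b => f b = l).card : ℤ)) := by
          refine sum_le_sum fun l _ => ?_
          rw [hδ, abs_le]; constructor <;> simp only <;> linarith [((B.filter fun b => g b = l).card : ℤ).le_refl,
            Int.natCast_nonneg (B.filter fun b => g b = l).card, Int.natCast_nonneg (B.filter fun b => f b = l).card]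
      _ = B.card + B.card := by rw [sum_add_distrib, hcardg, hcardf]
      _ ≤ 2 * c := by
          have : (B.card : ℤ) ≤ c := by exact_mod_cast hB
          linarith
  have hd1 : 1 ≤ ∑ l, (d l : ℤ) * δ l := by
    rw [← key (fun l => (d l : ℤ))]; linarith
  have := hu δ hδ1 hd1
  rw [← key u] at this
  linarith

/-- **Exponent-free compatible potentials**: for every `d : Fin K → ℕ` and `c` there is a class potential `u` with `0 ≤ u ≤ (2c+1)^K` that is
`c`-compatible with `d` on column sets of any size-`m` column type. [this cell's law + folklore LP] -/
theorem exists_compatible_allK (c : ℕ) (d : Fin K → ℕ) :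
    ∃ u : Fin K → ℤ, (∀ l, (0 : ℤ) ≤ u l ∧ u l ≤ (((2 * c + 1) ^ K : ℕ) : ℤ)) ∧
      ∀ B : Finset (Fin m), B.card ≤ c → ∀ f g : Fin m → Fin K,
        ∑ b ∈ B, (d (f b) : ℤ) < ∑ b ∈ B, (d (g b) : ℤ) → ∑ b ∈ B, u (f b) < ∑ b ∈ B, u (g b) := by
  obtain ⟨u, hU, hu⟩ := CompatHeight.exists_small_compatible K c d
  refine ⟨u, fun l => ⟨(hU l).1, by push_cast; exact (hU l).2⟩, fun B hB f g hfg => compatible_of_small c d u hu B hB f g hfg⟩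

variable (d : Fin K → ℕ) (v ε : Fin m → Fin m → Fin K → ℤ)

/-- **EXPONENT-FREE CYCLE POTENTIAL LAW.**  In every design of format `(m, K)`, every chain of terms dominant at strictly increasing slopes, consecutive
terms distinct, all of whose consecutive exchange quotients `σ_k⁻¹σ_{k+1}` have orbits of size `≤ c`, has `n ≤ m·(2c+1)^K`. [this cell's law] -/
theorem chain_le_allK (c : ℕ) {n : ℕ} (θ : Fin (n + 1) → ℤ) (p : Fin (n + 1) → Equiv.Perm (Fin m) × (Fin m → Fin K))
    (hθ : StrictMono θ) (hdom : ∀ k, IsDominant d v ε (θ k) (p k)) (hne : ∀ k : Fin n, p k.castSucc ≠ p k.succ)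
    (horb : ∀ k : Fin n, ∀ b : Fin m, ∃ T : Finset (Fin m), b ∈ T ∧ T.card ≤ c ∧
      ∀ x, ((p k.castSucc).1⁻¹ * (p k.succ).1) x ∈ T ↔ x ∈ T) :
    n ≤ m * (2 * c + 1) ^ K := by
  obtain ⟨u, hU, hu⟩ := exists_compatible_allK (m := m) c d
  have h := chain_le d v ε c u hu 0 (((2 * c + 1) ^ K : ℕ) : ℤ) hU θ p hθ hdom hne horb
  rw [sub_zero] at h
  exact_mod_cast h

/-- **Short steps.**  If every step of the chain changes at most `c ≥ 1` columns (in row or class), then `n ≤ m·(2c+1)^K` — any design, any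
exponents. [this cell's law] -/
theorem chain_le_allK_of_shortSteps (c : ℕ) (hc : 1 ≤ c) {n : ℕ} (θ : Fin (n + 1) → ℤ)
    (p : Fin (n + 1) → Equiv.Perm (Fin m) × (Fin m → Fin K))
    (hθ : StrictMono θ) (hdom : ∀ k, IsDominant d v ε (θ k) (p k)) (hne : ∀ k : Fin n, p k.castSucc ≠ p k.succ)
    (hstep : ∀ k : Fin n, (univ.filter fun i : Fin m =>
      (p k.castSucc).1 i ≠ (p k.succ).1 i ∨ (p k.castSucc).2 i ≠ (p k.succ).2 i).card ≤ c) :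
    n ≤ m * (2 * c + 1) ^ K :=
  chain_le_allK d v ε c θ p hθ hdom hne fun k b => exists_invariant_of_shortStep c hc (p k.castSucc) (p k.succ) (hstep k) b

/-- **With exceptions.**  If all steps outside `J` have orbits of size `≤ c`, then `n + 1 ≤ (#J + 1)·(m·(2c+1)^K + 1)`: a chain of `n + 1` terms in
ANY design has at least `(n+1)/(m(2c+1)^K + 1) − 1` steps whose exchange quotient has an orbit of more than `c` columns. [this cell's law] -/
theorem chain_le_allK_of_exceptions (c : ℕ) {n : ℕ} (θ : Fin (n + 1) → ℤ) (p : Fin (n + 1) → Equiv.Perm (Fin m) × (Fin m → Fin K))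
    (hθ : StrictMono θ) (hdom : ∀ k, IsDominant d v ε (θ k) (p k)) (hne : ∀ k : Fin n, p k.castSucc ≠ p k.succ)
    (J : Finset (Fin n))
    (horb : ∀ k : Fin n, k ∉ J → ∀ b : Fin m, ∃ T : Finset (Fin m), b ∈ T ∧ T.card ≤ c ∧
      ∀ x, ((p k.castSucc).1⁻¹ * (p k.succ).1) x ∈ T ↔ x ∈ T) :
    n + 1 ≤ (J.card + 1) * (m * (2 * c + 1) ^ K + 1) := by
  obtain ⟨u, hU, hu⟩ := exists_compatible_allK (m := m) c d
  have h := chain_le_of_exceptions d v ε c u hu 0 (((2 * c + 1) ^ K : ℕ) : ℤ) hU θ p hθ hdom hne J horb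
  rw [sub_zero] at h
  exact_mod_cast h

/-- **Sign-alternating form** (hypothesis list of `TropicalCensus.TropRootLawAt`): orbits `≤ c` ⇒ `n ≤ m·(2c+1)^K`. [this cell's law] -/
theorem chain_le_allK_alt (c : ℕ) {n : ℕ} (θ : Fin (n + 1) → ℤ) (p : Fin (n + 1) → Equiv.Perm (Fin m) × (Fin m → Fin K))
    (hθ : StrictMono θ) (hdom : ∀ k, IsDominant d v ε (θ k) (p k))
    (halt : ∀ k : Fin n, termSign ε (p k.castSucc) * termSign ε (p k.succ) < 0)
    (horb : ∀ k : Fin n, ∀ b : Fin m, ∃ T : Finset (Fin m), b ∈ T ∧ T.card ≤ c ∧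
      ∀ x, ((p k.castSucc).1⁻¹ * (p k.succ).1) x ∈ T ↔ x ∈ T) :
    n ≤ m * (2 * c + 1) ^ K :=
  chain_le_allK d v ε c θ p hθ hdom (ne_of_alt ε p halt) horb

end CyclePotential

end Summit.ValiantsHypothesis.ValiantsHypothesis.Theorems.KPlusLogSqLaw
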